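import Mathlib.Analysis.InnerProductSpace.Calculus
import Mathlib.Analysis.Calculus.MeanValue
import Mathlib.Analysis.SpecialFunctions.ExpDeriv
import Literature.Analysis.FluidPDE.NSCoriolis
import Literature.Analysis.FluidPDE.ClassicalSolutionTorusProofs
import Literature.Analysis.FluidPDE.TorusClassicalLerayHopfProofs
import Literature.Analysis.FluidPDE.DoeringFoiasPowerProofs
import Literature.Analysis.FunctionSpaces.TorusClassicalNSGluing
import Literature.Analysis.FunctionSpaces.TorusFourierCalculus
import HarnessLib

/-!
# The rotating Navier–Stokes system on the torus: energy equality and the rotation of the mean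

Analysis/FluidPDE proof file (theorems only; no definitions, no named facts), sibling of
`NSCoriolis.lean`, supporting the named fact
`Literature.Analysis.FluidPDE.bmn1999_rotating_ns_global_regularity` (Babin–Mahalov–Nicolaenko,
Indiana Univ. Math. J. 48 (1999), Thm. 1.1 = Thm. 5.3). It records the two elementary inputs of
the proof of Thm. 5.3 (IUMJ 48, p. 1170, (5.41)–(5.45) and Remark 5.2: "We have the energy
estimate for regular solutions"; p. 1134: "all physical fields are taken to have zero average over
the domain") for **classical `ℤ³`-periodic solutions of the Navier–Stokes–Coriolis system**,
read on the flat torus `𝕋³ = ℝ³/ℤ³` through the tree's torus bridge: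

* `IsClassicalNSCoriolisSolutionOn.to_torus` / `of_torus` / `lift_iff` — a classical solution of
  the rotating system on `ℝ³ × S` whose data are periodic lifts is exactly a classical
  Navier–Stokes solution on `𝕋³ × S` (`Torus.IsClassicalNSSolutionOn`) with the Coriolis term
  moved into the force, `f − Ω e₃ × u` (the forcing bridge
  `IsClassicalNSCoriolisSolutionOn.iff_isClassicalNSSolutionOn_forcing` composed with
  `IsClassicalNSSolutionOn.to_torus_holds` / `of_torus_holds`);
* `IsClassicalNSCoriolisSolutionOn.torus_energy_balance`, `torus_energy_eq` — **the energy
  identity of the rotating system is that of Navier–Stokes**: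
  `d/dt ½‖u(t)‖² = −ν‖∇u(t)‖₂² + ∫ ⟪f, u⟫` and its integrated form, the Coriolis force doing no
  work pointwise (`inner_coriolisForce_self`); for `f = 0`, `ν ≥ 0` the kinetic energy is
  non-increasing (`torus_kineticEnergy_le`, BMN (5.41)/(5.43) with `F = 0`);
* `integral_coriolisForce` — `∫ Ω e₃ × v = Ω e₃ × ∫ v`;
* `IsClassicalNSCoriolisSolutionOn.hasDerivWithinAt_torus_meanVelocity` — **the mean velocity
  rotates**: `d/dt ∫_{𝕋³} u(t) = ∫_{𝕋³} f(t) − Ω e₃ × ∫_{𝕋³} u(t)` (the mean of `(u·∇)u`, `Δu`,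
  `∇p` vanishes on the torus, `Torus.IsClassicalNSSolutionOn.hasDerivWithinAt_integral_velocity`);
  hence for mean-zero forces `‖∫ u(t)‖` is conserved (`norm_torus_meanVelocity_eq`) and **zero
  mean persists** (`torus_hasZeroMean`) — the consistency of BMN's zero-average convention with
  the unforced rotating dynamics;
* `Torus.integral_norm_sq_le_gradNormSq_of_hasZeroMean` — the Poincaré inequality
  `4π² ‖v‖₂² ≤ ‖∇v‖₂²` for smooth mean-zero fields (first Stokes eigenvalue `λ₁ = 4π²` on the unit
  torus; the tree's spectral form `ofReal_integral_norm_sq_le_eGradNormSq_add` read for smooth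
  fields), and the **exponential energy decay of the unforced rotating system**,
  `½‖u(t)‖² ≤ ½‖u(s)‖² e^{−8π²ν(t−s)}` (`torus_kineticEnergy_le_mul_exp`: BMN (5.43)–(5.44) with
  `F = 0`, there with the rate `νλ₁`).

## Mathlib / tree search

Mathlib: `HasDerivWithinAt.norm_sq`, `Convex.norm_image_sub_le_of_norm_hasDerivWithin_le`,
`antitoneOn_of_hasDerivWithinAt_nonpos`, `HasDerivAt.exp`,
`ContinuousLinearMap.integral_comp_comm`; no rotating-fluid notions, no Poincaré inequality on
the torus (the tree's: `ofReal_integral_norm_sq_le_eGradNormSq_add`, `DoeringFoiasPowerProofs`;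
`Torus.gradNormSq_eq_toReal_eGradNormSq_holds`, `Torus.eGradNormSq_lt_top`,
`TorusFourierCalculus`). Tree
(reused): `IsClassicalNSCoriolisSolutionOn` and its forcing bridge, `coriolisForce`, `crossCLM`
(`NSCoriolis`, `VectorCalculus`), the torus bridges `IsClassicalNSSolutionOn.to_torus_holds` /
`of_torus_holds` (`ClassicalSolutionTorusProofs`),
`Torus.IsClassicalNSSolutionOn.energy_balance_holds`,
`Torus.IsClassicalNSSolutionOn.energy_eq` (`TorusClassicalLerayHopfProofs`),
`Torus.IsClassicalNSSolutionOn.hasDerivWithinAt_integral_velocity` (`TorusClassicalNSGluing`).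

## References

* A. Babin, A. Mahalov, B. Nicolaenko, *Global regularity of 3D rotating Navier–Stokes equations
  for resonant domains*, Indiana Univ. Math. J. 48 (1999) 1133–1176: p. 1134 (zero averages),
  §1 (the Coriolis term), proof of Thm. 5.3, (5.41)–(5.45), Remark 5.2 (p. 1170).
  [BabinMahalovNicolaenko1999]
* J.-Y. Chemin, B. Desjardins, I. Gallagher, E. Grenier, *Mathematical Geophysics*, OUP (2006),
  Part II ("the Coriolis force … does not contribute to the energy estimates").
-/

noncomputable section

open MeasureTheory Set Function
open scoped ContDiff Laplacian InnerProductSpace RealInnerProductSpace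

namespace Literature.Analysis.FluidPDE

/-! ### The Coriolis force under the integral sign -/

/-- `coriolisForce Ω` is the continuous linear map `Ω • (e₃ × ·)`. [folklore] -/
theorem coriolisForce_eq_smul_crossCLM (Ω : ℝ) (v : EuclideanSpace ℝ (Fin 3)) :
    coriolisForce Ω v = (Ω • crossCLM e₃) v := rfl

/-- **The Coriolis force commutes with averaging**: `∫ Ω e₃ × v(x) dμ = Ω e₃ × ∫ v dμ` for an
integrable field (a continuous linear map passes under the Bochner integral). [folklore] -/
theorem integral_coriolisForce {α : Type*} [MeasurableSpace α] (μ : Measure α) (Ω : ℝ)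
    {v : α → EuclideanSpace ℝ (Fin 3)} (hv : Integrable v μ) :
    ∫ x, coriolisForce Ω (v x) ∂μ = coriolisForce Ω (∫ x, v x ∂μ) := by
  simp only [coriolisForce_eq_smul_crossCLM]
  exact ContinuousLinearMap.integral_comp_comm _ hv

/-- The Coriolis force is skew: `⟪v, Ω e₃ × v⟫ = 0` (the symmetric form of
`inner_coriolisForce_self`). [folklore] -/
theorem inner_self_coriolisForce (Ω : ℝ) (v : EuclideanSpace ℝ (Fin 3)) :
    ⟪v, coriolisForce Ω v⟫ = 0 := by
  rw [real_inner_comm, inner_coriolisForce_self]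

/-! ### Periodic classical solutions of the rotating system, read on the torus -/

namespace IsClassicalNSCoriolisSolutionOn

variable {S : Set ℝ} {ν Ω : ℝ} {f u : ℝ → UnitAddTorus (Fin 3) → EuclideanSpace ℝ (Fin 3)}
  {p : ℝ → UnitAddTorus (Fin 3) → ℝ}

/-- **Space-to-torus bridge for the rotating system.** A classical solution of the
Navier–Stokes–Coriolis system on `ℝ³ × S` whose force, velocity and pressure are periodic lifts
of fields on `𝕋³` is a classical Navier–Stokes solution on `𝕋³ × S` with force `f − Ω e₃ × u`
(the Coriolis term as a forcing, `iff_isClassicalNSSolutionOn_forcing`, then the torus bridge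
`IsClassicalNSSolutionOn.to_torus_holds`; BMN 1999, (1.1) with (2.3): the rotating system is the
Navier–Stokes system with the extra linear term `ΩPJPU`). [folklore] -/
theorem to_torus
    (h : IsClassicalNSCoriolisSolutionOn S ν Ω (fun t => FunctionSpaces.Torus.lift (f t))
      (fun t => FunctionSpaces.Torus.lift (u t)) (fun t => FunctionSpaces.Torus.lift (p t))) :
    FunctionSpaces.Torus.IsClassicalNSSolutionOn S ν (fun t x => f t x - coriolisForce Ω (u t x))
      u p :=
  IsClassicalNSSolutionOn.to_torus_holds (f := fun t x => f t x - coriolisForce Ω (u t x))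
    (iff_isClassicalNSSolutionOn_forcing.1 h)

/-- **Torus-to-space bridge for the rotating system**: conversely, a classical Navier–Stokes
solution on `𝕋³ × S` with force `f − Ω e₃ × u` lifts to a classical solution of the rotating
system on `ℝ³ × S` with force `f`, Coriolis parameter `Ω` and periodic data. [folklore] -/
theorem of_torus
    (h : FunctionSpaces.Torus.IsClassicalNSSolutionOn S ν
      (fun t x => f t x - coriolisForce Ω (u t x)) u p) :
    IsClassicalNSCoriolisSolutionOn S ν Ω (fun t => FunctionSpaces.Torus.lift (f t))
      (fun t => FunctionSpaces.Torus.lift (u t)) (fun t => FunctionSpaces.Torus.lift (p t)) :=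
  iff_isClassicalNSSolutionOn_forcing.2
    (IsClassicalNSSolutionOn.of_torus_holds (f := fun t x => f t x - coriolisForce Ω (u t x)) h)

/-- The two readings of a periodic classical solution of the rotating system agree
(`to_torus`, `of_torus`). [folklore] -/
theorem lift_iff :
    IsClassicalNSCoriolisSolutionOn S ν Ω (fun t => FunctionSpaces.Torus.lift (f t))
        (fun t => FunctionSpaces.Torus.lift (u t)) (fun t => FunctionSpaces.Torus.lift (p t)) ↔
      FunctionSpaces.Torus.IsClassicalNSSolutionOn S ν
        (fun t x => f t x - coriolisForce Ω (u t x)) u p :=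
  ⟨to_torus, of_torus⟩

/-- The Coriolis forcing drops out of the power of the force: `∫ ⟪f − Ω e₃ × u, u⟫ = ∫ ⟪f, u⟫`
pointwise in time (`inner_coriolisForce_self`). [folklore] -/
theorem integral_inner_force_sub_coriolisForce
    (f u : ℝ → UnitAddTorus (Fin 3) → EuclideanSpace ℝ (Fin 3)) (Ω t : ℝ) :
    ∫ x, ⟪f t x - coriolisForce Ω (u t x), u t x⟫ = ∫ x, ⟪f t x, u t x⟫ := by
  simp only [inner_sub_left, inner_coriolisForce_self, sub_zero]

/-- **Energy balance of the rotating system = that of Navier–Stokes** (BMN 1999, §1 and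
Remark 5.2; CDGG 2006, Part II): for a periodic classical solution on a convex time set `S`,
`t ↦ ½‖u(t)‖²_{L²(𝕋³)}` has one-sided derivative `−ν‖∇u(t)‖₂² + ∫ ⟪f(t), u(t)⟫` within `S` —
no `Ω`. (Torus energy balance `Torus.IsClassicalNSSolutionOn.energy_balance_holds` for the force
`f − Ω e₃ × u`, and `⟪Ω e₃ × u, u⟫ = 0`.)
[cite: BabinMahalovNicolaenko1999, Remark 5.2 with (5.43)] -/
theorem torus_energy_balance
    (h : IsClassicalNSCoriolisSolutionOn S ν Ω (fun t => FunctionSpaces.Torus.lift (f t))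
      (fun t => FunctionSpaces.Torus.lift (u t)) (fun t => FunctionSpaces.Torus.lift (p t)))
    (hS : Convex ℝ S) {t : ℝ} (ht : t ∈ S) :
    HasDerivWithinAt (fun s => FunctionSpaces.Torus.kineticEnergy (u s))
      (-ν * FunctionSpaces.Torus.gradNormSq (u t) + ∫ x, ⟪f t x, u t x⟫) S t := by
  have h1 := FunctionSpaces.Torus.IsClassicalNSSolutionOn.energy_balance_holds h.to_torus hS ht
  rwa [integral_inner_force_sub_coriolisForce] at h1

/-- **Energy equality of the rotating system** on a convex time set: for `[s, t] ⊆ S`,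
`½‖u(t)‖² + ν ∫ₛᵗ ‖∇u‖₂² = ½‖u(s)‖² + ∫ₛᵗ ∫ ⟪f, u⟫` (the integrated balance,
`Torus.IsClassicalNSSolutionOn.energy_eq`, the Coriolis power being zero; BMN 1999, (5.43) is its
Gronwall form). [cite: BabinMahalovNicolaenko1999, Remark 5.2 with (5.43)] -/
theorem torus_energy_eq
    (h : IsClassicalNSCoriolisSolutionOn S ν Ω (fun t => FunctionSpaces.Torus.lift (f t))
      (fun t => FunctionSpaces.Torus.lift (u t)) (fun t => FunctionSpaces.Torus.lift (p t)))
    (hS : Convex ℝ S) {s t : ℝ} (hst : s ≤ t) (hI : Icc s t ⊆ S) :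
    FunctionSpaces.Torus.kineticEnergy (u t) +
        ν * ∫ τ in s..t, FunctionSpaces.Torus.gradNormSq (u τ) =
      FunctionSpaces.Torus.kineticEnergy (u s) + ∫ τ in s..t, ∫ x, ⟪f τ x, u τ x⟫ := by
  have h1 := h.to_torus.energy_eq hS hst hI
  simpa only [integral_inner_force_sub_coriolisForce] using h1

/-- **The kinetic energy of the unforced rotating system does not increase** (`ν ≥ 0`):
`½‖u(t)‖² ≤ ½‖u(s)‖²` for `s ≤ t`, `[s, t] ⊆ S` (energy equality with `f = 0` and
`‖∇u‖₂² ≥ 0`; BMN 1999, (5.41)/(5.43) with `F = 0`).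
[cite: BabinMahalovNicolaenko1999, (5.41) and (5.43) with F = 0] -/
theorem torus_kineticEnergy_le
    (h : IsClassicalNSCoriolisSolutionOn S ν Ω 0 (fun t => FunctionSpaces.Torus.lift (u t))
      (fun t => FunctionSpaces.Torus.lift (p t)))
    (hν : 0 ≤ ν) (hS : Convex ℝ S) {s t : ℝ} (hst : s ≤ t) (hI : Icc s t ⊆ S) :
    FunctionSpaces.Torus.kineticEnergy (u t) ≤ FunctionSpaces.Torus.kineticEnergy (u s) := by
  have h0 : IsClassicalNSCoriolisSolutionOn S ν Ω
      (fun t => FunctionSpaces.Torus.lift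
        ((0 : ℝ → UnitAddTorus (Fin 3) → EuclideanSpace ℝ (Fin 3)) t))
      (fun t => FunctionSpaces.Torus.lift (u t)) (fun t => FunctionSpaces.Torus.lift (p t)) := h
  have h1 := torus_energy_eq h0 hS hst hI
  simp only [Pi.zero_apply, inner_zero_left, integral_zero, intervalIntegral.integral_zero,
    add_zero] at h1
  have h2 : 0 ≤ ∫ τ in s..t, FunctionSpaces.Torus.gradNormSq (u τ) :=
    intervalIntegral.integral_nonneg hst fun τ _ => FunctionSpaces.Torus.gradNormSq_nonneg _
  nlinarith [mul_nonneg hν h2]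

/-- **The mean velocity of the rotating system rotates** (BMN 1999, p. 1134: the zero-average
convention; (2.3): the mean mode `n = 0` sees only the Coriolis term): for a periodic classical
solution on a convex time set, `t ↦ ∫_{𝕋³} u(t)` has one-sided derivative
`∫_{𝕋³} f(t) − Ω e₃ × ∫_{𝕋³} u(t)` within `S` (the means of `(u·∇)u`, `Δu`, `∇p` vanish on the
torus, `Torus.IsClassicalNSSolutionOn.hasDerivWithinAt_integral_velocity`, and
`integral_coriolisForce`). The force slice `f t` is assumed integrable (automatic for the smooth
forces of classical solutions on non-degenerate intervals; needed here only to split the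
integral). [folklore] -/
theorem hasDerivWithinAt_torus_meanVelocity
    (h : IsClassicalNSCoriolisSolutionOn S ν Ω (fun t => FunctionSpaces.Torus.lift (f t))
      (fun t => FunctionSpaces.Torus.lift (u t)) (fun t => FunctionSpaces.Torus.lift (p t)))
    (hS : Convex ℝ S) {t : ℝ} (ht : t ∈ S) (hf : Integrable (f t) volume) :
    HasDerivWithinAt (fun s => ∫ x, u s x)
      ((∫ x, f t x) - coriolisForce Ω (∫ x, u t x)) S t := by
  have h1 := h.to_torus.hasDerivWithinAt_integral_velocity hS ht
  have hu : Integrable (u t) volume := (h.to_torus.smooth_velocity.isSmooth_slice ht).integrable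
  have hcu : Integrable (fun x => coriolisForce Ω (u t x)) volume := by
    simp only [coriolisForce_eq_smul_crossCLM]
    exact ContinuousLinearMap.integrable_comp _ hu
  rwa [integral_sub hf hcu, integral_coriolisForce _ _ hu] at h1

/-- The unforced case: `d/dt ∫_{𝕋³} u(t) = −Ω e₃ × ∫_{𝕋³} u(t)`. [folklore] -/
theorem hasDerivWithinAt_torus_meanVelocity_zero
    (h : IsClassicalNSCoriolisSolutionOn S ν Ω 0 (fun t => FunctionSpaces.Torus.lift (u t))
      (fun t => FunctionSpaces.Torus.lift (p t)))
    (hS : Convex ℝ S) {t : ℝ} (ht : t ∈ S) :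
    HasDerivWithinAt (fun s => ∫ x, u s x) (-coriolisForce Ω (∫ x, u t x)) S t := by
  have h0 : IsClassicalNSCoriolisSolutionOn S ν Ω
      (fun t => FunctionSpaces.Torus.lift
        ((0 : ℝ → UnitAddTorus (Fin 3) → EuclideanSpace ℝ (Fin 3)) t))
      (fun t => FunctionSpaces.Torus.lift (u t)) (fun t => FunctionSpaces.Torus.lift (p t)) := h
  have h1 := hasDerivWithinAt_torus_meanVelocity h0 hS ht (integrable_zero _ _ _)
  simpa only [Pi.zero_apply, integral_zero, zero_sub] using h1

/-- **The modulus of the mean velocity is conserved** by the unforced rotating system: the mean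
solves the linear ODE `m' = −Ω e₃ × m`, a rotation about `e₃`, and `d/dt ‖m‖² = −2⟪m, Ω e₃ × m⟫ = 0`
(`HasDerivWithinAt.norm_sq`, `inner_self_coriolisForce`; constancy on the convex time set by the
mean value inequality). [folklore] -/
theorem norm_torus_meanVelocity_eq
    (h : IsClassicalNSCoriolisSolutionOn S ν Ω 0 (fun t => FunctionSpaces.Torus.lift (u t))
      (fun t => FunctionSpaces.Torus.lift (p t)))
    (hS : Convex ℝ S) {s t : ℝ} (hs : s ∈ S) (ht : t ∈ S) :
    ‖∫ x, u t x‖ = ‖∫ x, u s x‖ := by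
  have hd : ∀ τ ∈ S, HasDerivWithinAt (fun σ => ‖∫ x, u σ x‖ ^ 2) ((fun _ => 0 : ℝ → ℝ) τ) S τ := by
    intro τ hτ
    have h1 := (hasDerivWithinAt_torus_meanVelocity_zero h hS hτ).norm_sq
    rwa [inner_neg_right, inner_self_coriolisForce, neg_zero, mul_zero] at h1
  have h0 := hS.norm_image_sub_le_of_norm_hasDerivWithin_le (C := 0) hd (fun τ _ => by simp) hs ht
  rw [zero_mul, norm_le_zero_iff, sub_eq_zero] at h0
  have h2 : ‖∫ x, u t x‖ ^ 2 = ‖∫ x, u s x‖ ^ 2 := h0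
  have h3 := congrArg Real.sqrt h2
  rwa [Real.sqrt_sq (norm_nonneg _), Real.sqrt_sq (norm_nonneg _)] at h3

/-- **Zero mean persists** for the unforced rotating system (BMN 1999, p. 1134: "all physical
fields are taken to have zero average over the domain" is consistent with the dynamics when
`F = 0`): if `∫_{𝕋³} u(s) = 0` at one time of a convex time set, then `∫_{𝕋³} u(t) = 0` at every
other. [cite: BabinMahalovNicolaenko1999, §1 p. 1134 (zero-average convention)] -/
theorem torus_hasZeroMean
    (h : IsClassicalNSCoriolisSolutionOn S ν Ω 0 (fun t => FunctionSpaces.Torus.lift (u t))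
      (fun t => FunctionSpaces.Torus.lift (p t)))
    (hS : Convex ℝ S) {s t : ℝ} (hs : s ∈ S) (ht : t ∈ S)
    (h0 : FunctionSpaces.Torus.HasZeroMean (u s)) : FunctionSpaces.Torus.HasZeroMean (u t) := by
  unfold FunctionSpaces.Torus.HasZeroMean at h0 ⊢
  rw [← norm_eq_zero, norm_torus_meanVelocity_eq h hS hs ht, h0, norm_zero]

end IsClassicalNSCoriolisSolutionOn

/-! ### Poincaré inequality and exponential energy decay -/

/-- **Poincaré inequality on the unit torus for smooth mean-zero vector fields**:
`4π² ∫ ‖v‖² ≤ ‖∇v‖₂²` (`λ₁ = 4π²` is the first eigenvalue of the Stokes / Laplace operator on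
`ℝ^d/ℤ^d`; BMN 1999, (5.43): "`λ₁` is the first eigenvalue of the Stokes operator"). The tree's
spectral Poincaré inequality `ofReal_integral_norm_sq_le_eGradNormSq_add` (`4π²‖v‖₂² ≤ ‖∇v‖₂² +
4π²‖∫ v‖²` in `[0, ∞]`) read for a smooth field, whose spectral and classical gradient norms
agree (`Torus.gradNormSq_eq_toReal_eGradNormSq_holds`) and are finite
(`Torus.eGradNormSq_lt_top`). [folklore] -/
theorem Torus.integral_norm_sq_le_gradNormSq_of_hasZeroMean {d : Type*} [Fintype d]
    [DecidableEq d] {v : UnitAddTorus d → EuclideanSpace ℝ d}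
    (hv : FunctionSpaces.Torus.IsSmooth v) (h0 : FunctionSpaces.Torus.HasZeroMean v) :
    4 * Real.pi ^ 2 * ∫ x, ‖v x‖ ^ 2 ≤ FunctionSpaces.Torus.gradNormSq v := by
  have h1 := ofReal_integral_norm_sq_le_eGradNormSq_add (hv.memLp 2)
  have h0' : ∫ x, v x = 0 := h0
  rw [h0', norm_zero, zero_pow two_ne_zero, mul_zero, ENNReal.ofReal_zero, add_zero] at h1
  rw [FunctionSpaces.Torus.gradNormSq_eq_toReal_eGradNormSq_holds hv]
  exact (ENNReal.ofReal_le_iff_le_toReal (FunctionSpaces.Torus.eGradNormSq_lt_top hv).ne).1 h1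

namespace IsClassicalNSCoriolisSolutionOn

variable {S : Set ℝ} {ν Ω : ℝ} {u : ℝ → UnitAddTorus (Fin 3) → EuclideanSpace ℝ (Fin 3)}
  {p : ℝ → UnitAddTorus (Fin 3) → ℝ}

/-- **Exponential decay of the energy of the unforced rotating system** (BMN 1999, Remark 5.2,
(5.43)–(5.44) with `F = 0`: "`‖U(t)‖₀² ≤ ‖U(0)‖₀² e^{−νλ₁t}`", `λ₁` the first Stokes eigenvalue;
here `λ₁ = 4π²` for unit periods and the sharper rate `2νλ₁ = 8π²ν` of the Gronwall argument):
for a periodic classical solution with `ν ≥ 0`, no force and mean-zero velocity at a time `s`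
of the convex time set `S`, `½‖u(t)‖² ≤ ½‖u(s)‖² · e^{−8π²ν(t−s)}` for `t ≥ s` in `S`. Proof:
zero mean persists (`torus_hasZeroMean`), so by the Poincaré inequality
`ν‖∇u‖₂² ≥ 8π²ν · ½‖u‖²` along the solution; with the energy balance
`d/dt ½‖u‖² = −ν‖∇u‖₂²` (`torus_energy_balance`), `t ↦ e^{8π²νt} · ½‖u(t)‖²` has a nonpositive
one-sided derivative on `S`, hence is non-increasing (`antitoneOn_of_hasDerivWithinAt_nonpos`).
[cite: BabinMahalovNicolaenko1999, Remark 5.2, (5.43)–(5.44) with F = 0] -/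
theorem torus_kineticEnergy_le_mul_exp
    (h : IsClassicalNSCoriolisSolutionOn S ν Ω 0 (fun t => FunctionSpaces.Torus.lift (u t))
      (fun t => FunctionSpaces.Torus.lift (p t)))
    (hν : 0 ≤ ν) (hS : Convex ℝ S) {s t : ℝ} (hs : s ∈ S) (ht : t ∈ S) (hst : s ≤ t)
    (h0 : FunctionSpaces.Torus.HasZeroMean (u s)) :
    FunctionSpaces.Torus.kineticEnergy (u t) ≤
      FunctionSpaces.Torus.kineticEnergy (u s) * Real.exp (-(8 * Real.pi ^ 2 * ν * (t - s))) := by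
  have h0' : IsClassicalNSCoriolisSolutionOn S ν Ω
      (fun t => FunctionSpaces.Torus.lift
        ((0 : ℝ → UnitAddTorus (Fin 3) → EuclideanSpace ℝ (Fin 3)) t))
      (fun t => FunctionSpaces.Torus.lift (u t)) (fun t => FunctionSpaces.Torus.lift (p t)) := h
  set c : ℝ := 8 * Real.pi ^ 2 * ν with hc
  set E : ℝ → ℝ := fun τ => FunctionSpaces.Torus.kineticEnergy (u τ) with hE
  -- the energy balance without force and without `Ω`
  have hdE : ∀ τ ∈ S, HasDerivWithinAt E (-ν * FunctionSpaces.Torus.gradNormSq (u τ)) S τ := by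
    intro τ hτ
    have h1 := torus_energy_balance h0' hS hτ
    simpa only [Pi.zero_apply, inner_zero_left, integral_zero, add_zero] using h1
  -- Poincaré along the solution (zero mean persists)
  have hP : ∀ τ ∈ S, 8 * Real.pi ^ 2 * E τ ≤ FunctionSpaces.Torus.gradNormSq (u τ) := by
    intro τ hτ
    have hsm : FunctionSpaces.Torus.IsSmooth (u τ) :=
      h0'.to_torus.smooth_velocity.isSmooth_slice hτ
    have hP' := Torus.integral_norm_sq_le_gradNormSq_of_hasZeroMean hsm
      (torus_hasZeroMean h hS hs hτ h0)
    calc 8 * Real.pi ^ 2 * E τ = 4 * Real.pi ^ 2 * ∫ x, ‖u τ x‖ ^ 2 := by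
          simp only [hE, FunctionSpaces.Torus.kineticEnergy]; ring
      _ ≤ _ := hP'
  -- `g = e^{ct} E` has nonpositive derivative within `S`
  have hdg : ∀ τ ∈ S, HasDerivWithinAt (fun σ => Real.exp (c * σ) * E σ)
      (Real.exp (c * τ) * (c * E τ - ν * FunctionSpaces.Torus.gradNormSq (u τ))) S τ := by
    intro τ hτ
    have h1 : HasDerivAt (fun σ => Real.exp (c * σ)) (Real.exp (c * τ) * c) τ := by
      simpa using ((hasDerivAt_id τ).const_mul c).exp
    refine ((h1.hasDerivWithinAt (s := S)).mul (hdE τ hτ)).congr_deriv ?_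
    ring
  have hg0 : ∀ τ ∈ S,
      Real.exp (c * τ) * (c * E τ - ν * FunctionSpaces.Torus.gradNormSq (u τ)) ≤ 0 := by
    intro τ hτ
    refine mul_nonpos_iff.2 (Or.inl ⟨Real.exp_nonneg _, ?_⟩)
    have e1 : c * E τ - ν * FunctionSpaces.Torus.gradNormSq (u τ) =
        ν * (8 * Real.pi ^ 2 * E τ - FunctionSpaces.Torus.gradNormSq (u τ)) := by
      rw [hc]; ring
    rw [e1]
    exact mul_nonpos_iff.2 (Or.inl ⟨hν, by linarith [hP τ hτ]⟩)
  have hanti : AntitoneOn (fun σ => Real.exp (c * σ) * E σ) S :=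
    antitoneOn_of_hasDerivWithinAt_nonpos hS (fun τ hτ => (hdg τ hτ).continuousWithinAt)
      (fun τ hτ => (hdg τ (interior_subset hτ)).mono interior_subset)
      (fun τ hτ => hg0 τ (interior_subset hτ))
  have h3 : Real.exp (c * t) * E t ≤ Real.exp (c * s) * E s := hanti hs ht hst
  have h4 : E t ≤ Real.exp (c * s) * E s / Real.exp (c * t) :=
    (le_div_iff₀' (Real.exp_pos _)).2 h3
  calc E t ≤ Real.exp (c * s) * E s / Real.exp (c * t) := h4
    _ = E s * Real.exp (c * s - c * t) := by rw [Real.exp_sub]; ring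
    _ = E s * Real.exp (-(c * (t - s))) := by congr 1; congr 1; ring

end IsClassicalNSCoriolisSolutionOn

end Literature.Analysis.FluidPDE

end
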